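/-
Copyright (c) 2026 the pub-hodgecm-mathlib formalisation cell (harness21).  Prover seat hodgecm-mathlib-K2E1-p08 (g5), Track B ∕ K2-LIT, h413 =
`stmt-HodgeConjecture-24833`, campaign «EIS-RANK-ONE» (q5) [D5]₃ SPHERICAL, E-layer file (E-a): the Faà di Bruno norm bound and power-of-a-symbol estimates
(dealer K2E1-plan (g4) 2026-09-04T07:04:17Z; REPORT-FIRST 07:08Z).
-/
import Mathlib
import Literature.NumberTheory.LFunctions.Zhang2022.Section4PartialIntegration   -- ★ `hasDerivAt_ofReal_cpow` (`d/du u^a = a u^{a-1}`, `u > 0`, all `a`)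
import HarnessLib

/-!
# K2·E1 — `K2E1SymbolFaaDiBruno` ((q5) [D5]₃ E-layer file (E-a)): THE FAÀ DI BRUNO NORM BOUND `‖Dⁿ(g ∘ f)(x)‖ ≤ Σ_c ‖D^{|c|}g(fx)‖·∏ᵢ ‖D^{cᵢ}f(x)‖`
# and POWERS OF SYMBOLS: `‖Dⁿ[f^{−w}](x)‖ ≤ C·f(x)^{−Re w}` whenever `f ≥ 1` and `‖Dⁱf‖ ≤ K·f` (`1 ≤ i ≤ n`)

Track B ∕ K2-LIT, crux h413 = `stmt-HodgeConjecture-24833`, route of record `HCCMUnconditional`; cell `hodgecm-mathlib`, squad K2, ENGINE E1, campaign EIS-RANK-ONE, queue item (q5)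
[D5]₃ (the `E`-layer binder `hφarchZ` of ★ p857895 for the spherical flat section).  Prover seat `hodgecm-mathlib-K2E1-p08` (g5).  THEOREMS ONLY (no `def`, no `instance`, no
notation, no named-fact hypothesis, no `sorry`); lane `--kind proof --supports stmt-HodgeConjecture-24833 --as helper` (count-neutral).  Pure calculus over Mathlib (a librarian may
re-home it under `Literature/Analysis/Calculus`).

WHAT.
* §1 **`norm_iteratedFDerivWithin_comp_le_sum`** — Mathlib's Faà di Bruno formula `HasFTaylorSeriesUpToOn.comp` (the Taylor series of `g ∘ f` is `taylorComp`, a sum over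
  `OrderedFinpartition n`) read as a NORM BOUND: `‖Dⁿ(g ∘ f)(x)‖ ≤ Σ_{c} ‖D^{c.length} g (f x)‖ · ∏ᵢ ‖D^{c.partSize i} f (x)‖` (`norm_compAlongOrderedFinpartition_le`), `Within` sets
  on both sides (so the outer function need only be smooth on an OPEN set containing the range — the cure of the «outer must be globally `ContDiff`» obstruction met by ★ (a1)),
  and the global corollary `norm_iteratedFDeriv_comp_le_sum_of_isOpen`.
* §2 the outer jet: on `u > 0`, `Dᵏ[u ↦ (u : ℂ)^{a}] = a(a−1)⋯(a−k+1)·u^{a−k}` (`iteratedDerivWithin_ofReal_cpow_Ioi`), with the norm `‖…‖ ≤ (∏_{l<k} (‖a‖ + l))·u^{Re a − k}`.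
* §3 **`exists_norm_iteratedFDeriv_rpow_neg_le_of_symbol`** — POWERS OF SYMBOLS: for `n`, `w ∈ ℂ`, `K ≥ 0` there is `C ≥ 0` such that for EVERY `C^n` function `f : X → ℝ` with `f ≥ 1`
  and `‖Dⁱf(x)‖ ≤ K·f(x)` (`1 ≤ i ≤ n`, all `x`): `‖Dⁿ[x ↦ (f x : ℂ)^{−w}](x)‖ ≤ C·f(x)^{−Re w}` — the constant does not see `f` (so it is uniform in every parameter `f` depends on).
[Hörmander ALPDO I §7.1 (functions of symbols); Mœglin–Waldspurger I.2.10–I.2.12.]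

HONEST LABEL: HC_CM is proved only modulo the 7 printed citations (2 remaining named inputs: hLiu418 = `stmt-HodgeConjecture-24832`, h413 = `stmt-HodgeConjecture-24833`) until
rung 0 closes; count-neutral helper, closes no socket.

## References
* [HormanderALPDO1] L. Hörmander, *The Analysis of Linear Partial Differential Operators I* (1983), §7.1.
* [MoeglinWaldspurger1995] C. Mœglin, J.-L. Waldspurger, *Spectral Decomposition and Eisenstein Series* (1995), I.2.10–I.2.12.
-/

set_option autoImplicit false
-- the mandated namespace repeats the single-problem summit's segment (`HodgeConjecture.HodgeConjecture`)
set_option linter.dupNamespace false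

noncomputable section

open Set
open scoped ContDiff

namespace Summit.HodgeConjecture.HodgeConjecture.Cruxes.H413.K2E1SymbolFaaDiBruno

/-! ## §1 The Faà di Bruno norm bound -/

section FaaDiBruno

variable {𝕜 : Type*} [NontriviallyNormedField 𝕜] {E F G : Type*} [NormedAddCommGroup E] [NormedSpace 𝕜 E] [NormedAddCommGroup F] [NormedSpace 𝕜 F]
  [NormedAddCommGroup G] [NormedSpace 𝕜 G]

/-- **FAÀ DI BRUNO, THE ITERATED DERIVATIVE OF A COMPOSITION IS `taylorComp`** (`Within` sets): for `g` `Cⁿ` on `t`, `f` `Cⁿ` on `s`, `f(s) ⊆ t`, unique differentiability on both,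
`Dⁿ(g ∘ f)|_s (x) = Σ_{c : OrderedFinpartition n} (D^{c.length} g|_t (f x)).compAlongOrderedFinpartition (D^{c.partSize ·} f|_s x) c` (Mathlib `HasFTaylorSeriesUpToOn.comp`).
[cite: HormanderALPDO1, §7.1] -/
theorem iteratedFDerivWithin_comp_eq_sum {g : F → G} {f : E → F} {s : Set E} {t : Set F} {n : ℕ}
    (hg : ContDiffOn 𝕜 n g t) (hf : ContDiffOn 𝕜 n f s) (ht : UniqueDiffOn 𝕜 t) (hs : UniqueDiffOn 𝕜 s) (hst : MapsTo f s t) {x : E} (hx : x ∈ s) :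
    iteratedFDerivWithin 𝕜 n (g ∘ f) s x =
      ∑ c : OrderedFinpartition n, c.compAlongOrderedFinpartition (iteratedFDerivWithin 𝕜 c.length g t (f x)) (fun m => iteratedFDerivWithin 𝕜 (c.partSize m) f s x) := by
  have H := (hg.ftaylorSeriesWithin ht).comp (hf.ftaylorSeriesWithin hs) hst
  rw [← H.eq_iteratedFDerivWithin_of_uniqueDiffOn le_rfl hs hx]
  rfl

/-- **THE FAÀ DI BRUNO NORM BOUND**: `‖Dⁿ(g ∘ f)|_s(x)‖ ≤ Σ_{c} ‖D^{c.length} g|_t (f x)‖ · ∏ᵢ ‖D^{c.partSize i} f|_s (x)‖` (§1 + Mathlib `norm_compAlongOrderedFinpartition_le`).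
[cite: HormanderALPDO1, §7.1] -/
theorem norm_iteratedFDerivWithin_comp_le_sum {g : F → G} {f : E → F} {s : Set E} {t : Set F} {n : ℕ}
    (hg : ContDiffOn 𝕜 n g t) (hf : ContDiffOn 𝕜 n f s) (ht : UniqueDiffOn 𝕜 t) (hs : UniqueDiffOn 𝕜 s) (hst : MapsTo f s t) {x : E} (hx : x ∈ s) :
    ‖iteratedFDerivWithin 𝕜 n (g ∘ f) s x‖ ≤
      ∑ c : OrderedFinpartition n, ‖iteratedFDerivWithin 𝕜 c.length g t (f x)‖ * ∏ m, ‖iteratedFDerivWithin 𝕜 (c.partSize m) f s x‖ := by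
  rw [iteratedFDerivWithin_comp_eq_sum hg hf ht hs hst hx]
  exact (norm_sum_le _ _).trans (Finset.sum_le_sum fun c _ => c.norm_compAlongOrderedFinpartition_le _ _)

/-- **Global form with an open target**: `f` `Cⁿ` on `E` with values in an OPEN set `t` on which `g` is `Cⁿ`:
`‖Dⁿ(g ∘ f)(x)‖ ≤ Σ_{c} ‖D^{c.length} g (f x)‖ · ∏ᵢ ‖D^{c.partSize i} f (x)‖` (all derivatives now the global ones; on an open set `Within = global`). [cite: HormanderALPDO1, §7.1] -/
theorem norm_iteratedFDeriv_comp_le_sum_of_isOpen {g : F → G} {f : E → F} {t : Set F} (ht : IsOpen t) {n : ℕ}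
    (hg : ContDiffOn 𝕜 n g t) (hf : ContDiff 𝕜 n f) (hst : ∀ x, f x ∈ t) (x : E) :
    ‖iteratedFDeriv 𝕜 n (g ∘ f) x‖ ≤
      ∑ c : OrderedFinpartition n, ‖iteratedFDeriv 𝕜 c.length g (f x)‖ * ∏ m, ‖iteratedFDeriv 𝕜 (c.partSize m) f x‖ := by
  have h := norm_iteratedFDerivWithin_comp_le_sum hg hf.contDiffOn ht.uniqueDiffOn uniqueDiffOn_univ (fun x _ => hst x) (mem_univ x)
  rw [iteratedFDerivWithin_univ] at h
  refine h.trans (le_of_eq (Finset.sum_congr rfl fun c _ => ?_))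
  rw [iteratedFDerivWithin_of_isOpen _ ht (hst x)]
  exact congrArg _ (Finset.prod_congr rfl fun m _ => by rw [iteratedFDerivWithin_univ])

end FaaDiBruno

/-! ## §2 The outer jet: `u ↦ (u : ℂ)^a` on `u > 0` -/

section OuterJet

/-- **THE JET OF THE POWER FUNCTION**: for `u > 0`, `Dᵏ[y ↦ (y : ℂ)^a](u) = (∏_{l<k} (a − l)) · u^{a − k}` (★ `hasDerivAt_ofReal_cpow`, locality of `deriv`). [folklore] -/
theorem iteratedDeriv_ofReal_cpow (a : ℂ) (k : ℕ) {u : ℝ} (hu : 0 < u) :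
    iteratedDeriv k (fun y : ℝ => (y : ℂ) ^ a) u = (∏ l ∈ Finset.range k, (a - l)) * (u : ℂ) ^ (a - k) := by
  induction k generalizing u with
  | zero => simp
  | succ k ih =>
    rw [iteratedDeriv_succ]
    have hev : iteratedDeriv k (fun y : ℝ => (y : ℂ) ^ a) =ᶠ[nhds u] fun y : ℝ => (∏ l ∈ Finset.range k, (a - l)) * (y : ℂ) ^ (a - k) :=
      Filter.eventuallyEq_of_mem (Ioi_mem_nhds hu) fun y hy => ih hy
    rw [hev.deriv_eq]
    have hd : HasDerivAt (fun y : ℝ => (∏ l ∈ Finset.range k, (a - l)) * (y : ℂ) ^ (a - k))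
        ((∏ l ∈ Finset.range k, (a - l)) * ((a - k) * (u : ℂ) ^ (a - k - 1))) u := (Literature.NumberTheory.LFunctions.Zhang2022.Lemma41.hasDerivAt_ofReal_cpow (a - k) hu).const_mul _
    rw [hd.deriv, Finset.prod_range_succ]
    push_cast
    ring_nf

/-- `‖∏_{l<k} (a − l)‖ ≤ ∏_{l<k} (‖a‖ + l)`. [folklore] -/
theorem norm_prod_sub_natCast_le (a : ℂ) (k : ℕ) : ‖∏ l ∈ Finset.range k, (a - (l : ℂ))‖ ≤ ∏ l ∈ Finset.range k, (‖a‖ + l) := by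
  rw [norm_prod]
  refine Finset.prod_le_prod (fun l _ => norm_nonneg _) fun l _ => ?_
  calc ‖a - (l : ℂ)‖ ≤ ‖a‖ + ‖(l : ℂ)‖ := norm_sub_le _ _
    _ = ‖a‖ + l := by rw [Complex.norm_natCast]

/-- **NORM OF THE JET**: `‖Dᵏ[(· : ℂ)^a](u)‖ ≤ (∏_{l<k} (‖a‖ + l)) · u^{Re a − k}` for `u > 0`. [folklore] -/
theorem norm_iteratedDeriv_ofReal_cpow_le (a : ℂ) (k : ℕ) {u : ℝ} (hu : 0 < u) :
    ‖iteratedDeriv k (fun y : ℝ => (y : ℂ) ^ a) u‖ ≤ (∏ l ∈ Finset.range k, (‖a‖ + l)) * u ^ (a.re - k) := by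
  rw [iteratedDeriv_ofReal_cpow a k hu, norm_mul, Complex.norm_cpow_eq_rpow_re_of_pos hu, Complex.sub_re, Complex.natCast_re]
  exact mul_le_mul_of_nonneg_right (norm_prod_sub_natCast_le a k) (Real.rpow_nonneg hu.le _)

/-- `y ↦ (y : ℂ)^a` is smooth on `u > 0` (it is `exp(a·log y)` there). [folklore] -/
theorem contDiffOn_ofReal_cpow (a : ℂ) {n : WithTop ℕ∞} : ContDiffOn ℝ n (fun y : ℝ => (y : ℂ) ^ a) (Ioi 0) := by
  have h : ContDiffOn ℝ n (fun y : ℝ => Complex.exp (Complex.ofRealCLM (Real.log y) * a)) (Ioi 0) :=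
    (((Complex.ofRealCLM.contDiff.comp_contDiffOn (Real.contDiffOn_log.mono fun y (hy : y ∈ Ioi (0 : ℝ)) => ne_of_gt hy)).mul contDiffOn_const).cexp)
  refine h.congr fun y hy => ?_
  have hy0 : (0 : ℝ) < y := hy
  rw [Complex.cpow_def_of_ne_zero (by exact_mod_cast hy0.ne'), Complex.ofRealCLM_apply, Complex.ofReal_log hy0.le]

end OuterJet

/-! ## §3 Powers of symbols -/

section PowerOfSymbol

variable {X : Type*} [NormedAddCommGroup X] [NormedSpace ℝ X]

/-- `1 ≤ c.partSize m ≤ n` bookkeeping: `∏ₘ (K·f) = K^{c.length}·f^{c.length}` bounds the inner product when every block has size in `[1, n]`. [folklore] -/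
theorem prod_norm_iteratedFDeriv_le_pow {n : ℕ} (c : OrderedFinpartition n) {f : X → ℝ} {K : ℝ} {x : X}
    (hb : ∀ i, 1 ≤ i → i ≤ n → ‖iteratedFDeriv ℝ i f x‖ ≤ K * f x) :
    ∏ m, ‖iteratedFDeriv ℝ (c.partSize m) f x‖ ≤ K ^ c.length * (f x) ^ c.length := by
  calc ∏ m, ‖iteratedFDeriv ℝ (c.partSize m) f x‖ ≤ ∏ _m : Fin c.length, K * f x :=
        Finset.prod_le_prod (fun m _ => norm_nonneg _) fun m _ => hb _ (Nat.one_le_iff_ne_zero.2 (c.neZero_partSize m).out) (c.partSize_le m)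
    _ = K ^ c.length * (f x) ^ c.length := by rw [Finset.prod_const, Finset.card_univ, Fintype.card_fin, mul_pow]

/-- **POWERS OF SYMBOLS ARE SYMBOLS, WITH A CONSTANT THAT DOES NOT SEE THE FUNCTION.**  For `n ∈ ℕ`, `w ∈ ℂ`, `K ≥ 0` put `C = Σ_{c : OrderedFinpartition n} (∏_{l<|c|} (‖w‖ + l))·K^{|c|}`.
Then for EVERY `Cⁿ` function `f : X → ℝ` with `f ≥ 1` and `‖Dⁱ f(x)‖ ≤ K·f(x)` for `1 ≤ i ≤ n` (at the point `x`): `‖Dⁿ[x ↦ (f x : ℂ)^{−w}](x)‖ ≤ C · f(x)^{−Re w}` (§1 with outer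
`u ↦ u^{−w}` on the open half-line `u > ½`, §2 for its jet `‖Dᵏ‖ ≤ (∏(‖w‖+l))·u^{−Re w − k}`, and `f^{−Re w − k}·(K f)^k = Kᵏ·f^{−Re w}`). [cite: HormanderALPDO1, §7.1] -/
theorem norm_iteratedFDeriv_cpow_neg_le_of_symbol (n : ℕ) (w : ℂ) {K : ℝ} {f : X → ℝ} (hf : ContDiff ℝ n f) (hf1 : ∀ x, 1 ≤ f x)
    {x : X} (hb : ∀ i, 1 ≤ i → i ≤ n → ‖iteratedFDeriv ℝ i f x‖ ≤ K * f x) :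
    ‖iteratedFDeriv ℝ n (fun x => ((f x : ℝ) : ℂ) ^ (-w)) x‖ ≤
      (∑ c : OrderedFinpartition n, (∏ l ∈ Finset.range c.length, (‖w‖ + l)) * K ^ c.length) * (f x) ^ (-w.re) := by
  have hpos : ∀ y, 0 < f y := fun y => zero_lt_one.trans_le (hf1 y)
  have ht : IsOpen (Ioi (1 / 2 : ℝ)) := isOpen_Ioi
  have hst : ∀ y, f y ∈ Ioi (1 / 2 : ℝ) := fun y => lt_of_lt_of_le (by norm_num) (hf1 y)
  have hg : ContDiffOn ℝ n (fun u : ℝ => (u : ℂ) ^ (-w)) (Ioi (1 / 2 : ℝ)) :=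
    (contDiffOn_ofReal_cpow (-w)).mono fun u (hu : u ∈ Ioi (1 / 2 : ℝ)) => lt_trans (by norm_num : (0 : ℝ) < 1 / 2) hu
  have h := norm_iteratedFDeriv_comp_le_sum_of_isOpen ht hg hf hst x
  rw [show ((fun u : ℝ => (u : ℂ) ^ (-w)) ∘ f) = fun x => ((f x : ℝ) : ℂ) ^ (-w) from rfl] at h
  refine h.trans ?_
  rw [Finset.sum_mul]
  refine Finset.sum_le_sum fun c _ => ?_
  have h1 : ‖iteratedFDeriv ℝ c.length (fun u : ℝ => (u : ℂ) ^ (-w)) (f x)‖ ≤ (∏ l ∈ Finset.range c.length, (‖w‖ + l)) * (f x) ^ (-w.re - c.length) := by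
    rw [norm_iteratedFDeriv_eq_norm_iteratedDeriv]
    have h := norm_iteratedDeriv_ofReal_cpow_le (-w) c.length (hpos x)
    rwa [norm_neg, Complex.neg_re] at h
  have h2 := prod_norm_iteratedFDeriv_le_pow c hb
  have hP : 0 ≤ ∏ l ∈ Finset.range c.length, (‖w‖ + (l : ℝ)) := Finset.prod_nonneg fun l _ => by positivity
  calc ‖iteratedFDeriv ℝ c.length (fun u : ℝ => (u : ℂ) ^ (-w)) (f x)‖ * ∏ m, ‖iteratedFDeriv ℝ (c.partSize m) f x‖
      ≤ ((∏ l ∈ Finset.range c.length, (‖w‖ + l)) * (f x) ^ (-w.re - c.length)) * (K ^ c.length * (f x) ^ c.length) :=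
        mul_le_mul h1 h2 (Finset.prod_nonneg fun m _ => norm_nonneg _) (mul_nonneg hP (Real.rpow_nonneg (hpos x).le _))
    _ = (∏ l ∈ Finset.range c.length, (‖w‖ + l)) * K ^ c.length * ((f x) ^ (-w.re - c.length) * (f x) ^ (c.length : ℝ)) := by
        rw [Real.rpow_natCast]; ring
    _ = (∏ l ∈ Finset.range c.length, (‖w‖ + l)) * K ^ c.length * (f x) ^ (-w.re) := by
        rw [← Real.rpow_add (hpos x)]; ring_nf

/-- **THE UNIFORM EDITION**: `∀ n w K, ∃ C ≥ 0, ∀ f (Cⁿ, f ≥ 1, ‖Dⁱf‖ ≤ K·f for 1 ≤ i ≤ n everywhere), ∀ x, ‖Dⁿ[f^{−w}](x)‖ ≤ C·f(x)^{−Re w}` — the constant is a closed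
expression in `(n, ‖w‖, K)`, so ONE constant serves a whole family of functions `f`. [cite: HormanderALPDO1, §7.1] [cite: MoeglinWaldspurger1995, I.2.10–I.2.12] -/
theorem exists_norm_iteratedFDeriv_cpow_neg_le_of_symbol (n : ℕ) (w : ℂ) {K : ℝ} (hK : 0 ≤ K) :
    ∃ C : ℝ, 0 ≤ C ∧ ∀ (f : X → ℝ), ContDiff ℝ n f → (∀ x, 1 ≤ f x) → (∀ i, 1 ≤ i → i ≤ n → ∀ x, ‖iteratedFDeriv ℝ i f x‖ ≤ K * f x) →
      ∀ x, ‖iteratedFDeriv ℝ n (fun x => ((f x : ℝ) : ℂ) ^ (-w)) x‖ ≤ C * (f x) ^ (-w.re) :=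
  ⟨∑ c : OrderedFinpartition n, (∏ l ∈ Finset.range c.length, (‖w‖ + l)) * K ^ c.length,
    Finset.sum_nonneg fun c _ => mul_nonneg (Finset.prod_nonneg fun l _ => by positivity) (pow_nonneg hK _),
    fun _ hf hf1 hb x => norm_iteratedFDeriv_cpow_neg_le_of_symbol n w hf hf1 fun i hi hin => hb i hi hin x⟩

end PowerOfSymbol

end Summit.HodgeConjecture.HodgeConjecture.Cruxes.H413.K2E1SymbolFaaDiBruno

end
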